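import Mathlib
import Summits.ValiantsHypothesis.ValiantsHypothesis.Theorems.BorderApolarityToricWitnessObstructionQPTLFChart
import Summits.ValiantsHypothesis.ValiantsHypothesis.Theorems.BorderApolarityToricWitnessObstructionQPJetRegime

/-!
# Border apolarity, crux `ToricWitnessObstructionQP` — no x₀₀-dominant torus leading form of
# `per₃` below Grenet's size (`TLF 3 m` + dominance ⟹ `7 ≤ m`)

Route `ValiantsHypothesis/BorderApolarity`, crux item `stmt-ValiantsHypothesis-14753`, line `Sketch`
(lead c6).  The disprover's standing targets `not_tlf_three_five`, `not_tlf_three_six`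
(`Cruxes/ToricWitnessObstructionQP/Disproof.lean` §4) ask whether `per₃` is a TORUS LEADING FORM of
size `5` or `6`: data `e' a₀ γ G₀ G` with `deg_s det(s^{a₀} G₀ + Σ s^{γ ij} X_ij G_ij) ≤ e'` and
`[s^{e'}] det(…) = per₃`.  This file settles them on the x₀₀-DOMINANT CONE of weight classes:

* `tlf_dominant_seven_le`: if moreover every monomial `x₀₀^{m-|μ|} y^μ` of degree `|μ| ≤ 2` in
  `y` is torus-heavier than the permanent, `e' < a₀ (m - |μ|) + γ·μ` (all constant, linear and
  quadratic garbage is forbidden — the cone in which every computed toric witness lives, lead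
  c4/c5), then `7 ≤ m`.

Proof: by the chart lemma (`tlf_chart`) the chart determinant `F = det M̂` over
`Option (Fin 3 × Fin 3)` has all `ŵ`-weights `≤ e'` and top component `X none^{m-3}·per₃`;
dehomogenising (`x₀₀ ↦ 1`, coefficient formula `coeff_some_aeval_spec`) gives the affine matrix
`A = M̂(x₀₀ := 1)` whose determinant `P` has `P₀ = P₁ = P₂ = 0` (dominance) and whose cubic part
has `per₃` as top `γ`-component of weight `e' - a₀ (m - 3)`; `jetRegime_seven_le` (lead c5,
Alper–Bogart–Velasco strengthened) concludes.  (For `m < 3` the hypotheses are contradictory: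
`F = 0`.)
-/

open MvPolynomial
open scoped BigOperators Matrix Polynomial

-- the mandated summit-side namespace repeats a component by design (single-problem summit)
set_option linter.dupNamespace false

namespace Summit.ValiantsHypothesis.ValiantsHypothesis.Theorems.BorderApolarityToricWitnessObstructionQP

noncomputable section

namespace TLFChart

open Literature.Computability.AlgebraicComplexity
open Literature.AlgebraicGeometry.Resolution (dehomogenize coeff_dehomogenize_of_isHomogeneous)

variable {n m : ℕ}

/-- Weight of a lifted exponent: `ŵ (μ.optionElim k) = k • a₀ + weight γ' μ` for
`ŵ = Option.elim · a₀ γ'`. [folklore] -/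
theorem weight_optionElim {σ : Type*} (a₀ : ℕ) (γ' : σ → ℕ) (μ : σ →₀ ℕ) (k : ℕ) :
    Finsupp.weight (fun v : Option σ => v.elim a₀ γ') (μ.optionElim k) = a₀ * k + Finsupp.weight γ' μ := by
  rw [Finsupp.weight_apply, Finsupp.sum_option_index_smul, Finsupp.optionElim_apply_none,
    Finsupp.some_optionElim, Finsupp.weight_apply]
  simp only [Option.elim_none, Option.elim_some, smul_eq_mul]
  rw [mul_comm]

/-- Degree of a lifted exponent: `|μ.optionElim k| = k + |μ|`. [folklore] -/
theorem degree_optionElim {σ : Type*} (μ : σ →₀ ℕ) (k : ℕ) :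
    (μ.optionElim k).degree = k + μ.degree := by
  have h := weight_optionElim (σ := σ) 1 (fun _ => 1) μ k
  have h1 : (fun v : Option σ => v.elim (1 : ℕ) (fun _ : σ => (1 : ℕ))) = fun _ => 1 := by
    funext v; cases v <;> rfl
  rw [h1, one_mul] at h
  rw [Finsupp.degree_eq_weight_one, Finsupp.degree_eq_weight_one]
  exact h

/-- **Coefficient formula for the specialisation `x₀₀ ↦ 1` on forms**: for a form `Φ` of degree
`d` over `Option σ'`, `σ' = Fin n × Fin n`, and an exponent `α` of degree `d`,
`coeff α.some (Φ(x₀₀ := 1)) = coeff α Φ`. [folklore] -/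
theorem coeff_some_aeval_spec {Φ : MvPolynomial (Option (Fin n × Fin n)) ℂ} {d : ℕ}
    (hΦ : Φ.IsHomogeneous d) (α : Option (Fin n × Fin n) →₀ ℕ) (hα : α.degree = d) :
    coeff α.some (aeval (fun v : Option (Fin n × Fin n) =>
      v.elim (1 : MvPolynomial (Fin n × Fin n) ℂ) X) Φ) = coeff α Φ := by
  classical
  have key : (α.subtypeDomain (· ≠ none)).mapDomain
      (fun q : {v : Option (Fin n × Fin n) // v ≠ none} =>
        q.1.get (Option.ne_none_iff_isSome.mp q.2)) = α.some := by
    ext p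
    have hp : (fun q : {v : Option (Fin n × Fin n) // v ≠ none} =>
        q.1.get (Option.ne_none_iff_isSome.mp q.2)) ⟨some p, Option.some_ne_none p⟩ = p := rfl
    conv_lhs => rw [← hp]
    rw [Finsupp.mapDomain_apply get_injective, Finsupp.subtypeDomain_apply, Finsupp.some_apply]
  rw [aeval_spec_eq_rename_dehomogenize, AlgHom.comp_apply, ← key,
    coeff_rename_mapDomain _ get_injective]
  exact coeff_dehomogenize_of_isHomogeneous (R := ℂ) none hΦ hα

/-- Every exponent over `Option σ` is the lift of its `some`-part. [folklore] -/
theorem optionElim_some_eq {σ : Type*} (α : Option σ →₀ ℕ) : (α.some).optionElim (α none) = α :=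
  Finsupp.optionElim_some α

/-- **No x₀₀-dominant torus leading form of `per₃` has size `≤ 6`.**  If `(e', a₀, γ, G₀, G)` is a
TLF datum of size `m` for `per₃` and every monomial of `y`-degree `≤ 2` is torus-heavier than the
permanent (`e' < a₀ (m - |μ|) + γ·μ` for `|μ| ≤ 2`), then `7 ≤ m`. [folklore] -/
theorem dominant_seven_le (e' a₀ : ℕ) (γ : Fin 3 → Fin 3 → ℕ)
    (G₀ : Matrix (Fin m) (Fin m) ℂ) (G : Fin 3 → Fin 3 → Matrix (Fin m) (Fin m) ℂ)
    (hdeg : (Matrix.of fun a b : Fin m => Polynomial.monomial a₀ (C (G₀ a b)) +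
        ∑ i : Fin 3, ∑ j : Fin 3, Polynomial.monomial (γ i j) (C (G i j a b) * X (i, j)) :
          Matrix (Fin m) (Fin m) (Polynomial (MvPolynomial (Fin 3 × Fin 3) ℂ))).det.natDegree ≤ e')
    (hcoeff : (Matrix.of fun a b : Fin m => Polynomial.monomial a₀ (C (G₀ a b)) +
        ∑ i : Fin 3, ∑ j : Fin 3, Polynomial.monomial (γ i j) (C (G i j a b) * X (i, j)) :
          Matrix (Fin m) (Fin m) (Polynomial (MvPolynomial (Fin 3 × Fin 3) ℂ))).det.coeff e' =
        perPoly (Fin 3) ℂ)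
    (hdom : ∀ μ : Fin 3 × Fin 3 →₀ ℕ, μ.degree ≤ 2 →
      e' < a₀ * (m - μ.degree) + Finsupp.weight (fun p : Fin 3 × Fin 3 => γ p.1 p.2) μ) :
    7 ≤ m := by
  classical
  -- notation: the chart determinant, its weights, the specialisation and the affine matrix
  set Mh : Matrix (Fin m) (Fin m) (MvPolynomial (Option (Fin 3 × Fin 3)) ℂ) :=
    Matrix.of fun a b : Fin m => G₀ a b • X none +
      ∑ i : Fin 3, ∑ j : Fin 3, G i j a b • X (some (i, j)) with hMh
  set F : MvPolynomial (Option (Fin 3 × Fin 3)) ℂ := Mh.det with hF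
  set ŵ : Option (Fin 3 × Fin 3) → ℕ := fun v => v.elim a₀ fun p => γ p.1 p.2 with hŵ
  set γ' : Fin 3 × Fin 3 → ℕ := fun p => γ p.1 p.2 with hγ'
  set spec : Option (Fin 3 × Fin 3) → MvPolynomial (Fin 3 × Fin 3) ℂ :=
    fun v => v.elim (1 : MvPolynomial (Fin 3 × Fin 3) ℂ) X with hspec
  set A : Matrix (Fin m) (Fin m) (MvPolynomial (Fin 3 × Fin 3) ℂ) := Mh.map (aeval spec) with hA
  set P : MvPolynomial (Fin 3 × Fin 3) ℂ := A.det with hP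
  have hPF : P = aeval spec F := by
    rw [hP, hA, hF, AlgHom.map_det, AlgHom.mapMatrix_apply]
  have hFhom : F.IsHomogeneous m := by rw [hF, hMh]; exact chartDet_isHomogeneous G₀ G
  have hŵ' : ŵ = fun v => v.elim a₀ γ' := by rw [hŵ, hγ']
  -- the weight bound (i') from the chart lemma (valid without `3 ≤ m`)
  have hcoefF : ∀ j, (Matrix.of fun a b : Fin m => Polynomial.monomial a₀ (C (G₀ a b)) +
        ∑ i : Fin 3, ∑ j : Fin 3, Polynomial.monomial (γ i j) (C (G i j a b) * X (i, j)) :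
          Matrix (Fin m) (Fin m) (Polynomial (MvPolynomial (Fin 3 × Fin 3) ℂ))).det.coeff j =
      aeval spec (weightedHomogeneousComponent ŵ j F) := by
    intro j
    rw [hF, hMh, hŵ, hspec]
    exact coeff_pencil_eq_aeval_component a₀ γ G₀ G j
  have hwt : ∀ d ∈ F.support, Finsupp.weight ŵ d ≤ e' := by
    intro d hd
    by_contra hlt
    rw [not_le] at hlt
    have hzero : weightedHomogeneousComponent ŵ (Finsupp.weight ŵ d) F = 0 := by
      refine eq_zero_of_aeval_spec_eq_zero
        (isHomogeneous_weightedHomogeneousComponent ŵ _ hFhom) ?_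
      rw [← hspec, ← hcoefF]
      exact Polynomial.coeff_eq_zero_of_natDegree_lt (lt_of_le_of_lt hdeg hlt)
    have h0 : coeff d (weightedHomogeneousComponent ŵ (Finsupp.weight ŵ d) F) = 0 := by
      rw [hzero, coeff_zero]
    rw [coeff_weightedHomogeneousComponent, if_pos rfl] at h0
    exact (mem_support_iff.mp hd) h0
  -- every monomial of `F` has `y`-degree `≥ 3` (dominance)
  have hydeg : ∀ d ∈ F.support, 3 ≤ (Finsupp.some d).degree := by
    intro d hd
    by_contra hlt
    rw [not_le] at hlt
    have hdm : d.degree = m := by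
      by_contra hne
      exact (mem_support_iff.mp hd) (hFhom.coeff_eq_zero hne)
    have hsplit : d = (d.some).optionElim (d none) := (optionElim_some_eq d).symm
    have hdeg' : d none + (d.some).degree = m := by
      rw [← hdm]; conv_rhs => rw [hsplit]; rw [degree_optionElim]
    have hw : Finsupp.weight ŵ d = a₀ * (d none) + Finsupp.weight γ' d.some := by
      conv_lhs => rw [hsplit, hŵ']
      rw [weight_optionElim]
    have h1 := hwt d hd
    have h2 := hdom d.some (by omega)
    rw [hw] at h1
    have h3 : m - (d.some).degree = d none := by omega
    rw [h3] at h2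
    exact lt_irrefl _ (lt_of_lt_of_le h2 h1)
  -- hence `3 ≤ m` (otherwise `F = 0` and the pencil coefficient `per₃` would vanish)
  have h3m : 3 ≤ m := by
    by_contra hlt
    rw [not_le] at hlt
    have hF0 : F = 0 := by
      by_contra hne
      obtain ⟨d, hd⟩ := ne_zero_iff.mp hne
      have hd' : d ∈ F.support := mem_support_iff.mpr hd
      have hdm : d.degree = m := by
        by_contra hne'
        exact hd (hFhom.coeff_eq_zero hne')
      have hsplit : d = (d.some).optionElim (d none) := (optionElim_some_eq d).symm
      have hdeg' : d none + (d.some).degree = m := by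
        rw [← hdm]; conv_rhs => rw [hsplit]; rw [degree_optionElim]
      have := hydeg d hd'
      omega
    have := hcoefF e'
    rw [hcoeff, hF0, map_zero, map_zero] at this
    exact perPoly_ne_zero (Fin 3) ℂ this
  -- the chart lemma proper: top component = homogenised permanent
  obtain ⟨-, -, htopF⟩ := chart h3m e' a₀ γ G₀ G hdeg hcoeff F (by rw [hF, hMh]) ŵ hŵ
  -- coefficients of `P` in terms of `F`
  have hcoefP : ∀ μ : Fin 3 × Fin 3 →₀ ℕ, μ.degree ≤ m →
      coeff μ P = coeff (μ.optionElim (m - μ.degree)) F := by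
    intro μ hμ
    have hαdeg : (μ.optionElim (m - μ.degree)).degree = m := by
      rw [degree_optionElim]; omega
    rw [hPF, ← coeff_some_aeval_spec hFhom _ hαdeg, Finsupp.some_optionElim]
  -- coefficients of `per₃` in terms of the top component of `F`
  have hper_hom : (perPoly (Fin 3) ℂ).IsHomogeneous 3 := by
    simpa using (perPoly_isHomogeneous (n := Fin 3) (k := ℂ))
  have hcoefPer : ∀ μ : Fin 3 × Fin 3 →₀ ℕ, μ.degree = 3 →
      coeff μ (perPoly (Fin 3) ℂ) =
        if Finsupp.weight ŵ (μ.optionElim (m - 3)) = e' then coeff (μ.optionElim (m - 3)) F else 0 := by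
    intro μ hμ
    have hαdeg : (μ.optionElim (m - 3)).degree = m := by
      rw [degree_optionElim]; omega
    have hHhom := isHomogeneous_X_pow_mul_rename_perPoly (n := 3) (m := m) h3m
    have h1 := coeff_some_aeval_spec hHhom _ hαdeg
    rw [aeval_spec_X_pow_mul_rename_perPoly, Finsupp.some_optionElim] at h1
    rw [h1, ← htopF, coeff_weightedHomogeneousComponent]
  -- `a₀ (m - 3) ≤ e'`: otherwise every cubic coefficient of `per₃` vanishes
  have ha₀ : a₀ * (m - 3) ≤ e' := by
    by_contra hlt
    rw [not_le] at hlt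
    obtain ⟨μ₀, hμ₀⟩ := ne_zero_iff.mp (perPoly_ne_zero (Fin 3) ℂ)
    have hμ₀deg : μ₀.degree = 3 := by
      by_contra hne
      exact hμ₀ (hper_hom.coeff_eq_zero hne)
    rw [hcoefPer μ₀ hμ₀deg] at hμ₀
    split_ifs at hμ₀ with h
    · rw [hŵ', weight_optionElim] at h
      omega
    · exact hμ₀ rfl
  -- the affine matrix and the jet hypotheses
  have hAentry : ∀ a b, A a b = G₀ a b • (1 : MvPolynomial (Fin 3 × Fin 3) ℂ) +
      ∑ i : Fin 3, ∑ j : Fin 3, G i j a b • X (i, j) := by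
    intro a b
    rw [hA, Matrix.map_apply, hMh, Matrix.of_apply]
    simp only [map_add, map_sum, map_smul, aeval_X, hspec, Option.elim_none, Option.elim_some]
  have hAdeg : ∀ a b, (A a b).totalDegree ≤ 1 := by
    intro a b
    rw [hAentry]
    refine (totalDegree_add _ _).trans (max_le ?_ ?_)
    · exact (totalDegree_smul_le _ _).trans (by rw [totalDegree_one]; exact Nat.zero_le _)
    · refine (totalDegree_finsetSum _ _).trans (Finset.sup_le fun i _ => ?_)
      refine (totalDegree_finsetSum _ _).trans (Finset.sup_le fun j _ => ?_)
      exact (totalDegree_smul_le _ _).trans (totalDegree_X _).le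
  have hlow : ∀ k ≤ 2, homogeneousComponent k P = 0 := by
    intro k hk
    ext μ
    rw [coeff_homogeneousComponent, coeff_zero]
    split_ifs with hμ
    · rw [hcoefP μ (by omega)]
      by_contra hne
      have hmem : μ.optionElim (m - μ.degree) ∈ F.support := mem_support_iff.mpr hne
      have := hydeg _ hmem
      rw [Finsupp.some_optionElim] at this
      omega
    · rfl
  have h3 : ∀ μ : Fin 3 × Fin 3 →₀ ℕ, coeff μ (homogeneousComponent 3 P) =
      if μ.degree = 3 then coeff (μ.optionElim (m - 3)) F else 0 := by
    intro μ
    rw [coeff_homogeneousComponent]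
    split_ifs with hμ
    · rw [hcoefP μ (by omega), hμ]
    · rfl
  have hwe : ∀ μ ∈ (homogeneousComponent 3 P).support, Finsupp.weight γ' μ ≤ e' - a₀ * (m - 3) := by
    intro μ hμ
    have hc := mem_support_iff.mp hμ
    rw [h3] at hc
    split_ifs at hc with hμ3
    · have hmem : μ.optionElim (m - 3) ∈ F.support := mem_support_iff.mpr hc
      have h1 := hwt _ hmem
      rw [hŵ', weight_optionElim] at h1
      omega
    · exact absurd rfl hc
  have htop : weightedHomogeneousComponent γ' (e' - a₀ * (m - 3)) (homogeneousComponent 3 P) =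
      perPoly (Fin 3) ℂ := by
    ext μ
    rw [coeff_weightedHomogeneousComponent, h3]
    by_cases hμ3 : μ.degree = 3
    · rw [hcoefPer μ hμ3, if_pos hμ3, hŵ', weight_optionElim]
      by_cases hw : Finsupp.weight γ' μ = e' - a₀ * (m - 3)
      · rw [if_pos hw, if_pos (by omega)]
      · rw [if_neg hw, if_neg (by omega)]
    · rw [if_neg hμ3, hper_hom.coeff_eq_zero hμ3]
      split_ifs <;> rfl
  exact jetRegime_seven_le A hAdeg (hlow 0 (by norm_num)) (hlow 1 (by norm_num))
    (hlow 2 le_rfl) γ' (e' - a₀ * (m - 3)) hwe htop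

end TLFChart

/-- **No x₀₀-dominant torus leading form of `per₃` below Grenet's size** (registered helper form of
`TLFChart.dominant_seven_le`): a TLF datum `(e', a₀, γ, G₀, G)` of size `m` for `per₃`
(`deg_s det(pencil) ≤ e'`, `[s^{e'}] det(pencil) = per₃`) in an x₀₀-dominant weight class
(`e' < a₀ (m - |μ|) + γ·μ` for all `|μ| ≤ 2`) has `7 ≤ m`.  Closes the disprover's targets
`not_tlf_three_five/six` on the dominant cone. [folklore] -/
theorem tlf_dominant_seven_le : ∀ {m : ℕ} (e' a₀ : ℕ) (γ : Fin 3 → Fin 3 → ℕ) (G₀ : Matrix (Fin m) (Fin m) ℂ) (G : Fin 3 → Fin 3 → Matrix (Fin m) (Fin m) ℂ), (Matrix.of fun a b : Fin m => Polynomial.monomial a₀ (MvPolynomial.C (G₀ a b)) + ∑ i : Fin 3, ∑ j : Fin 3, Polynomial.monomial (γ i j) (MvPolynomial.C (G i j a b) * MvPolynomial.X (i, j)) : Matrix (Fin m) (Fin m) (Polynomial (MvPolynomial (Fin 3 × Fin 3) ℂ))).det.natDegree ≤ e' → (Matrix.of fun a b : Fin m => Polynomial.monomial a₀ (MvPolynomial.C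 (G₀ a b)) + ∑ i : Fin 3, ∑ j : Fin 3, Polynomial.monomial (γ i j) (MvPolynomial.C (G i j a b) * MvPolynomial.X (i, j)) : Matrix (Fin m) (Fin m) (Polynomial (MvPolynomial (Fin 3 × Fin 3) ℂ))).det.coeff e' = Literature.Computability.AlgebraicComplexity.perPoly (Fin 3) ℂ → (∀ μ : Fin 3 × Fin 3 →₀ ℕ, μ.degree ≤ 2 → e' < a₀ * (m - μ.degree) + Finsupp.weight (fun p : Fin 3 × Fin 3 => γ p.1 p.2) μ) → 7 ≤ m :=
  fun e' a₀ γ G₀ G hdeg hcoeff hdom => TLFChart.dominant_seven_le e' a₀ γ G₀ G hdeg hcoeff hdom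

end

end Summit.ValiantsHypothesis.ValiantsHypothesis.Theorems.BorderApolarityToricWitnessObstructionQP
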